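import Summits.BirchSwinnertonDyer.BirchSwinnertonDyer.Theorems.ResidualThetaTransportAtTwoThetaLayerLambdaCongruenceAtTwoCuspSpanFourInvariance
import HarnessLib

/-!
# Route `ResidualThetaTransportAtTwo`, cruxes Kan⁺ (stmt-BirchSwinnertonDyer-20688) / 21437: the `K/E` certificate
# calculus for the `B₁`-character (residue facts, transport, three-term rules in `K/E` form)

Cell `bsd-wall`, lead prover `bsd-wall-rtt-p3` g9 (2026-08-28). THEOREMS ONLY; `--supports stmt-BirchSwinnertonDyer-20688`;
BSD is not proved by this. For an additive `χ : Γ₀(N) → ZMod 2` killing the small-trace elements, the two FACT SHAPES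
(spelled inline, no definition):

* `K(r)`: `∀ β, b(β) = −1 → d(β) ≡ r → χ β = 0`;
* `E(r, s)`: `∀ β β', b = −1 → b' = −1 → d(β) ≡ r → d(β') ≡ s → χ β = χ β'`.

LEMMAS. `E_of_mul_eq_neg_one` (`r s = −1`, any level, `…FourInvariance` Thm 1); `E_of_eq_four_mul` (`r = 4 s`, prime level,
`…FourInvariance` Thm 2, Dirichlet); `E_symm`, `E_trans`, `K_of_K_of_E` (transport), `E_of_K_of_K`; and the three-term
rules of `…CuspSpanGenerationB1` in `K/E` form: for the triple `(u, v, w)` of `K_rule_pos` (`w = uv`, `a₁ + d₂ = 1`) resp.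
`K_rule_neg` (`w = a₁a₂`, `a₁ + d₂ = −1`) one has `χ(β_u) + χ(β_v) + χ(β_w) = 0`, hence (`KE_rule_pos/neg`, six implications)
`E(u,v) → K(w)`, `E(u,w) → K(v)`, `E(v,w) → K(u)`, `K(u) → E(v,w)`, `K(v) → E(u,w)`, `K(w) → E(u,v)`.
These are exactly the moves of the certificate search `prop2.py` (one seed per orbit of `u ↦ 4u`, `u ↦ −1/u`; zero
propagation plus same-orbit equalities), which succeeds at every odd prime `p < 12000`.

References: [Rademacher1929] §1; [Knapp1993] Prop. 11.1; [Pollack2003] Conj. 6.3.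
-/

set_option autoImplicit false
set_option linter.dupNamespace false

open scoped MatrixGroups

open CongruenceSubgroup

namespace Summit.BirchSwinnertonDyer.BirchSwinnertonDyer.Theorems.SignedMuAtTwo

section AnyLevel

variable {N : ℕ} {χ : Gamma0 N → ZMod 2}

/-- `E(r, s)` from `r s = −1` (the `S`-companion). [folklore] -/
theorem E_of_mul_eq_neg_one (hadd : ∀ γ δ : Gamma0 N, χ (γ * δ) = χ γ + χ δ)
    (hsmall : ∀ γ : Gamma0 N, ((γ : SL(2, ℤ)) 0 0 + (γ : SL(2, ℤ)) 1 1).natAbs ≤ 2 → χ γ = 0)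
    (r s : ZMod N) (h : r * s = -1) :
    ∀ β β' : Gamma0 N, (β : SL(2, ℤ)) 0 1 = -1 → (β' : SL(2, ℤ)) 0 1 = -1 →
      ((((β : SL(2, ℤ)) 1 1 : ℤ) : ZMod N)) = r → ((((β' : SL(2, ℤ)) 1 1 : ℤ) : ZMod N)) = s → χ β = χ β' :=
  fun _ _ hb hb' hd hd' ↦ chi_eq_of_b_neg_one_of_mul_d_eq_neg_one hadd hsmall hb hb' (by rw [hd, hd', h])

/-- `E` is symmetric. [folklore] -/
theorem E_symm (r s : ZMod N) :
    (∀ β β' : Gamma0 N, (β : SL(2, ℤ)) 0 1 = -1 → (β' : SL(2, ℤ)) 0 1 = -1 →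
      ((((β : SL(2, ℤ)) 1 1 : ℤ) : ZMod N)) = r → ((((β' : SL(2, ℤ)) 1 1 : ℤ) : ZMod N)) = s → χ β = χ β') →
    ∀ β β' : Gamma0 N, (β : SL(2, ℤ)) 0 1 = -1 → (β' : SL(2, ℤ)) 0 1 = -1 →
      ((((β : SL(2, ℤ)) 1 1 : ℤ) : ZMod N)) = s → ((((β' : SL(2, ℤ)) 1 1 : ℤ) : ZMod N)) = r → χ β = χ β' :=
  fun E β β' hb hb' hd hd' ↦ (E β' β hb' hb hd' hd).symm

/-- `E` is transitive through a unit residue `s` (`s s' = 1`). [folklore] -/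
theorem E_trans [NeZero N] (r s t s' : ZMod N) (hs : s * s' = 1) :
    (∀ β β' : Gamma0 N, (β : SL(2, ℤ)) 0 1 = -1 → (β' : SL(2, ℤ)) 0 1 = -1 →
      ((((β : SL(2, ℤ)) 1 1 : ℤ) : ZMod N)) = r → ((((β' : SL(2, ℤ)) 1 1 : ℤ) : ZMod N)) = s → χ β = χ β') →
    (∀ β β' : Gamma0 N, (β : SL(2, ℤ)) 0 1 = -1 → (β' : SL(2, ℤ)) 0 1 = -1 →
      ((((β : SL(2, ℤ)) 1 1 : ℤ) : ZMod N)) = s → ((((β' : SL(2, ℤ)) 1 1 : ℤ) : ZMod N)) = t → χ β = χ β') →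
    ∀ β β' : Gamma0 N, (β : SL(2, ℤ)) 0 1 = -1 → (β' : SL(2, ℤ)) 0 1 = -1 →
      ((((β : SL(2, ℤ)) 1 1 : ℤ) : ZMod N)) = r → ((((β' : SL(2, ℤ)) 1 1 : ℤ) : ZMod N)) = t → χ β = χ β' := by
  intro E1 E2 β β'' hb hb'' hd hd''
  obtain ⟨β', hb', hd'⟩ := exists_b_neg_one_of_isUnit (N := N) (IsUnit.of_mul_eq_one s' hs)
  rw [E1 β β' hb hb' hd hd', E2 β' β'' hb' hb'' hd' hd'']

/-- Transport: `K(r)` and `E(r, s)` give `K(s)` (`r` a unit, `r r' = 1`). [folklore] -/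
theorem K_of_K_of_E [NeZero N] (r s r' : ZMod N) (hr : r * r' = 1) :
    (∀ β : Gamma0 N, (β : SL(2, ℤ)) 0 1 = -1 → ((((β : SL(2, ℤ)) 1 1 : ℤ) : ZMod N)) = r → χ β = 0) →
    (∀ β β' : Gamma0 N, (β : SL(2, ℤ)) 0 1 = -1 → (β' : SL(2, ℤ)) 0 1 = -1 →
      ((((β : SL(2, ℤ)) 1 1 : ℤ) : ZMod N)) = r → ((((β' : SL(2, ℤ)) 1 1 : ℤ) : ZMod N)) = s → χ β = χ β') →
    ∀ β : Gamma0 N, (β : SL(2, ℤ)) 0 1 = -1 → ((((β : SL(2, ℤ)) 1 1 : ℤ) : ZMod N)) = s → χ β = 0 := by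
  intro K E β' hb' hd'
  obtain ⟨β, hb, hd⟩ := exists_b_neg_one_of_isUnit (N := N) (IsUnit.of_mul_eq_one r' hr)
  rw [← E β β' hb hb' hd hd', K β hb hd]

/-- `K(r)` and `K(s)` give `E(r, s)`. [folklore] -/
theorem E_of_K_of_K (r s : ZMod N) :
    (∀ β : Gamma0 N, (β : SL(2, ℤ)) 0 1 = -1 → ((((β : SL(2, ℤ)) 1 1 : ℤ) : ZMod N)) = r → χ β = 0) →
    (∀ β : Gamma0 N, (β : SL(2, ℤ)) 0 1 = -1 → ((((β : SL(2, ℤ)) 1 1 : ℤ) : ZMod N)) = s → χ β = 0) →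
    ∀ β β' : Gamma0 N, (β : SL(2, ℤ)) 0 1 = -1 → (β' : SL(2, ℤ)) 0 1 = -1 →
      ((((β : SL(2, ℤ)) 1 1 : ℤ) : ZMod N)) = r → ((((β' : SL(2, ℤ)) 1 1 : ℤ) : ZMod N)) = s → χ β = χ β' :=
  fun K1 K2 β β' hb hb' hd hd' ↦ by rw [K1 β hb hd, K2 β' hb' hd']

/-- The six `K/E` consequences of a three-term identity `χ β₁ + χ β₂ + χ γ = 0` (`γ` any `b = −1` element of residue `w`,
`β₁, β₂` fixed of residues `u, v`). [folklore] -/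
theorem KE_six [NeZero N] (hadd : ∀ γ δ : Gamma0 N, χ (γ * δ) = χ γ + χ δ)
    (hsmall : ∀ γ : Gamma0 N, ((γ : SL(2, ℤ)) 0 0 + (γ : SL(2, ℤ)) 1 1).natAbs ≤ 2 → χ γ = 0)
    {β₁ β₂ : Gamma0 N} (h1 : (β₁ : SL(2, ℤ)) 0 1 = -1) (h2 : (β₂ : SL(2, ℤ)) 0 1 = -1) (u v w : ZMod N)
    (hu : ((((β₁ : SL(2, ℤ)) 1 1 : ℤ) : ZMod N)) = u) (hv : ((((β₂ : SL(2, ℤ)) 1 1 : ℤ) : ZMod N)) = v) (hw : IsUnit w)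
    (core : ∀ γ : Gamma0 N, (γ : SL(2, ℤ)) 0 1 = -1 → ((((γ : SL(2, ℤ)) 1 1 : ℤ) : ZMod N)) = w → χ β₁ + χ β₂ + χ γ = 0) :
    ((∀ β β' : Gamma0 N, (β : SL(2, ℤ)) 0 1 = -1 → (β' : SL(2, ℤ)) 0 1 = -1 →
        ((((β : SL(2, ℤ)) 1 1 : ℤ) : ZMod N)) = u → ((((β' : SL(2, ℤ)) 1 1 : ℤ) : ZMod N)) = v → χ β = χ β') →
      ∀ β : Gamma0 N, (β : SL(2, ℤ)) 0 1 = -1 → ((((β : SL(2, ℤ)) 1 1 : ℤ) : ZMod N)) = w → χ β = 0) ∧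
    ((∀ β β' : Gamma0 N, (β : SL(2, ℤ)) 0 1 = -1 → (β' : SL(2, ℤ)) 0 1 = -1 →
        ((((β : SL(2, ℤ)) 1 1 : ℤ) : ZMod N)) = u → ((((β' : SL(2, ℤ)) 1 1 : ℤ) : ZMod N)) = w → χ β = χ β') →
      ∀ β : Gamma0 N, (β : SL(2, ℤ)) 0 1 = -1 → ((((β : SL(2, ℤ)) 1 1 : ℤ) : ZMod N)) = v → χ β = 0) ∧
    ((∀ β β' : Gamma0 N, (β : SL(2, ℤ)) 0 1 = -1 → (β' : SL(2, ℤ)) 0 1 = -1 →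
        ((((β : SL(2, ℤ)) 1 1 : ℤ) : ZMod N)) = v → ((((β' : SL(2, ℤ)) 1 1 : ℤ) : ZMod N)) = w → χ β = χ β') →
      ∀ β : Gamma0 N, (β : SL(2, ℤ)) 0 1 = -1 → ((((β : SL(2, ℤ)) 1 1 : ℤ) : ZMod N)) = u → χ β = 0) ∧
    ((∀ β : Gamma0 N, (β : SL(2, ℤ)) 0 1 = -1 → ((((β : SL(2, ℤ)) 1 1 : ℤ) : ZMod N)) = u → χ β = 0) →
      ∀ β β' : Gamma0 N, (β : SL(2, ℤ)) 0 1 = -1 → (β' : SL(2, ℤ)) 0 1 = -1 →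
        ((((β : SL(2, ℤ)) 1 1 : ℤ) : ZMod N)) = v → ((((β' : SL(2, ℤ)) 1 1 : ℤ) : ZMod N)) = w → χ β = χ β') ∧
    ((∀ β : Gamma0 N, (β : SL(2, ℤ)) 0 1 = -1 → ((((β : SL(2, ℤ)) 1 1 : ℤ) : ZMod N)) = v → χ β = 0) →
      ∀ β β' : Gamma0 N, (β : SL(2, ℤ)) 0 1 = -1 → (β' : SL(2, ℤ)) 0 1 = -1 →
        ((((β : SL(2, ℤ)) 1 1 : ℤ) : ZMod N)) = u → ((((β' : SL(2, ℤ)) 1 1 : ℤ) : ZMod N)) = w → χ β = χ β') ∧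
    ((∀ β : Gamma0 N, (β : SL(2, ℤ)) 0 1 = -1 → ((((β : SL(2, ℤ)) 1 1 : ℤ) : ZMod N)) = w → χ β = 0) →
      ∀ β β' : Gamma0 N, (β : SL(2, ℤ)) 0 1 = -1 → (β' : SL(2, ℤ)) 0 1 = -1 →
        ((((β : SL(2, ℤ)) 1 1 : ℤ) : ZMod N)) = u → ((((β' : SL(2, ℤ)) 1 1 : ℤ) : ZMod N)) = v → χ β = χ β') := by
  have aux1 : ∀ x y : ZMod 2, x + x + y = 0 → y = 0 := by decide
  have aux2 : ∀ x y : ZMod 2, 0 + x + y = 0 → x = y := by decide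
  have aux3 : ∀ x y : ZMod 2, x + 0 + y = 0 → x = y := by decide
  have aux4 : ∀ x y : ZMod 2, x + y + 0 = 0 → x = y := by decide
  have aux5 : ∀ x y : ZMod 2, x + y + x = 0 → y = 0 := by decide
  have aux6 : ∀ x y : ZMod 2, x + y + y = 0 → x = 0 := by decide
  have tu : ∀ γ : Gamma0 N, (γ : SL(2, ℤ)) 0 1 = -1 → ((((γ : SL(2, ℤ)) 1 1 : ℤ) : ZMod N)) = u → χ γ = χ β₁ :=
    fun γ hb hd ↦ chi_eq_of_apply_zero_one_eq_neg_one hadd hsmall hb h1 (by rw [hd, hu])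
  have tv : ∀ γ : Gamma0 N, (γ : SL(2, ℤ)) 0 1 = -1 → ((((γ : SL(2, ℤ)) 1 1 : ℤ) : ZMod N)) = v → χ γ = χ β₂ :=
    fun γ hb hd ↦ chi_eq_of_apply_zero_one_eq_neg_one hadd hsmall hb h2 (by rw [hd, hv])
  obtain ⟨β₃, h3, hd3⟩ := exists_b_neg_one_of_isUnit (N := N) hw
  have c3 := core β₃ h3 hd3
  refine ⟨fun E γ hb hd ↦ ?_, fun E γ hb hd ↦ ?_, fun E γ hb hd ↦ ?_, fun K γ γ' hb hb' hd hd' ↦ ?_,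
    fun K γ γ' hb hb' hd hd' ↦ ?_, fun K γ γ' hb hb' hd hd' ↦ ?_⟩
  · have c := core γ hb hd
    rw [E β₁ β₂ h1 h2 hu hv] at c
    exact aux1 _ _ c
  · rw [tv γ hb hd]
    rw [E β₁ β₃ h1 h3 hu hd3] at c3
    exact aux5 _ _ c3
  · rw [tu γ hb hd]
    rw [E β₂ β₃ h2 h3 hv hd3] at c3
    exact aux6 _ _ c3
  · rw [tv γ hb hd]
    have c := core γ' hb' hd'
    rw [K β₁ h1 hu] at c
    exact aux2 _ _ c
  · rw [tu γ hb hd]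
    have c := core γ' hb' hd'
    rw [K β₂ h2 hv] at c
    exact aux3 _ _ c
  · rw [tu γ hb hd, tv γ' hb' hd']
    rw [K β₃ h3 hd3] at c3
    exact aux4 _ _ c3

/-- **Three-term rule `η = +1` in `K/E` form.** Data as in `K_rule_pos` (`a₁d₁ + c₁ = 1`, `a₂d₂ + c₂ = 1`, `N ∣ c₁, c₂`,
`a₁ + d₂ = 1`, `u = d₁`, `v = d₂`, `w = d₁d₂`); conclusion: the six implications of `KE_six`. [folklore] -/
theorem KE_rule_pos [NeZero N] (hadd : ∀ γ δ : Gamma0 N, χ (γ * δ) = χ γ + χ δ)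
    (hsmall : ∀ γ : Gamma0 N, ((γ : SL(2, ℤ)) 0 0 + (γ : SL(2, ℤ)) 1 1).natAbs ≤ 2 → χ γ = 0)
    (a₁ d₁ c₁ a₂ d₂ c₂ : ℤ) (e1 : a₁ * d₁ + c₁ = 1) (hc1 : (N : ℤ) ∣ c₁) (e2 : a₂ * d₂ + c₂ = 1) (hc2 : (N : ℤ) ∣ c₂)
    (h12 : a₁ + d₂ = 1) (u v w : ZMod N) (hu : ((d₁ : ℤ) : ZMod N) = u) (hv : ((d₂ : ℤ) : ZMod N) = v)
    (hw : ((d₁ * d₂ : ℤ) : ZMod N) = w) :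
    ((∀ β β' : Gamma0 N, (β : SL(2, ℤ)) 0 1 = -1 → (β' : SL(2, ℤ)) 0 1 = -1 →
        ((((β : SL(2, ℤ)) 1 1 : ℤ) : ZMod N)) = u → ((((β' : SL(2, ℤ)) 1 1 : ℤ) : ZMod N)) = v → χ β = χ β') →
      ∀ β : Gamma0 N, (β : SL(2, ℤ)) 0 1 = -1 → ((((β : SL(2, ℤ)) 1 1 : ℤ) : ZMod N)) = w → χ β = 0) ∧
    ((∀ β β' : Gamma0 N, (β : SL(2, ℤ)) 0 1 = -1 → (β' : SL(2, ℤ)) 0 1 = -1 →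
        ((((β : SL(2, ℤ)) 1 1 : ℤ) : ZMod N)) = u → ((((β' : SL(2, ℤ)) 1 1 : ℤ) : ZMod N)) = w → χ β = χ β') →
      ∀ β : Gamma0 N, (β : SL(2, ℤ)) 0 1 = -1 → ((((β : SL(2, ℤ)) 1 1 : ℤ) : ZMod N)) = v → χ β = 0) ∧
    ((∀ β β' : Gamma0 N, (β : SL(2, ℤ)) 0 1 = -1 → (β' : SL(2, ℤ)) 0 1 = -1 →
        ((((β : SL(2, ℤ)) 1 1 : ℤ) : ZMod N)) = v → ((((β' : SL(2, ℤ)) 1 1 : ℤ) : ZMod N)) = w → χ β = χ β') →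
      ∀ β : Gamma0 N, (β : SL(2, ℤ)) 0 1 = -1 → ((((β : SL(2, ℤ)) 1 1 : ℤ) : ZMod N)) = u → χ β = 0) ∧
    ((∀ β : Gamma0 N, (β : SL(2, ℤ)) 0 1 = -1 → ((((β : SL(2, ℤ)) 1 1 : ℤ) : ZMod N)) = u → χ β = 0) →
      ∀ β β' : Gamma0 N, (β : SL(2, ℤ)) 0 1 = -1 → (β' : SL(2, ℤ)) 0 1 = -1 →
        ((((β : SL(2, ℤ)) 1 1 : ℤ) : ZMod N)) = v → ((((β' : SL(2, ℤ)) 1 1 : ℤ) : ZMod N)) = w → χ β = χ β') ∧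
    ((∀ β : Gamma0 N, (β : SL(2, ℤ)) 0 1 = -1 → ((((β : SL(2, ℤ)) 1 1 : ℤ) : ZMod N)) = v → χ β = 0) →
      ∀ β β' : Gamma0 N, (β : SL(2, ℤ)) 0 1 = -1 → (β' : SL(2, ℤ)) 0 1 = -1 →
        ((((β : SL(2, ℤ)) 1 1 : ℤ) : ZMod N)) = u → ((((β' : SL(2, ℤ)) 1 1 : ℤ) : ZMod N)) = w → χ β = χ β') ∧
    ((∀ β : Gamma0 N, (β : SL(2, ℤ)) 0 1 = -1 → ((((β : SL(2, ℤ)) 1 1 : ℤ) : ZMod N)) = w → χ β = 0) →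
      ∀ β β' : Gamma0 N, (β : SL(2, ℤ)) 0 1 = -1 → (β' : SL(2, ℤ)) 0 1 = -1 →
        ((((β : SL(2, ℤ)) 1 1 : ℤ) : ZMod N)) = u → ((((β' : SL(2, ℤ)) 1 1 : ℤ) : ZMod N)) = v → χ β = χ β') := by
  obtain ⟨β₁, h100, h101, h110, h111⟩ :=
    ThetaLayerLambdaCongruenceAtTwo.exists_gamma0_entries (N := N) a₁ (-1) c₁ d₁ (by linear_combination e1) hc1
  obtain ⟨β₂, -, h201, -, h211⟩ :=
    ThetaLayerLambdaCongruenceAtTwo.exists_gamma0_entries (N := N) a₂ (-1) c₂ d₂ (by linear_combination e2) hc2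
  have hb : ((β₁ * β₂ : Gamma0 N) : SL(2, ℤ)) 0 1 = -1 := by
    rw [gamma0_mul_apply_zero_one, h100, h201, h101, h211]; linear_combination (-1 : ℤ) * h12
  have hc : (((β₁ : SL(2, ℤ)) 1 0 : ℤ) : ZMod N) = 0 := by
    rw [h110]; exact (ZMod.intCast_zmod_eq_zero_iff_dvd _ N).mpr hc1
  have hdw : ((((β₁ * β₂ : Gamma0 N) : SL(2, ℤ)) 1 1 : ℤ) : ZMod N) = w := by
    rw [gamma0_mul_apply_one_one', h201, h111, h211, ← hw]; push_cast; rw [hc]; ring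
  refine KE_six hadd hsmall h101 h201 u v w (by rw [h111, hu]) (by rw [h211, hv])
    (by rw [← hdw]; exact isUnit_gamma0_apply_one_one _) ?_
  intro γ hγ hd
  rw [chi_eq_of_apply_zero_one_eq_neg_one hadd hsmall hγ hb (by rw [hd, hdw]), hadd]
  generalize χ β₁ = x; generalize χ β₂ = y; revert x y; decide

/-- **Three-term rule `η = −1` in `K/E` form.** Data as in `K_rule_neg` (`a₁ + d₂ = −1`, `w = a₁a₂`). [folklore] -/
theorem KE_rule_neg [NeZero N] (hadd : ∀ γ δ : Gamma0 N, χ (γ * δ) = χ γ + χ δ)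
    (hsmall : ∀ γ : Gamma0 N, ((γ : SL(2, ℤ)) 0 0 + (γ : SL(2, ℤ)) 1 1).natAbs ≤ 2 → χ γ = 0)
    (a₁ d₁ c₁ a₂ d₂ c₂ : ℤ) (e1 : a₁ * d₁ + c₁ = 1) (hc1 : (N : ℤ) ∣ c₁) (e2 : a₂ * d₂ + c₂ = 1) (hc2 : (N : ℤ) ∣ c₂)
    (h12 : a₁ + d₂ = -1) (u v w : ZMod N) (hu : ((d₁ : ℤ) : ZMod N) = u) (hv : ((d₂ : ℤ) : ZMod N) = v)
    (hw : ((a₁ * a₂ : ℤ) : ZMod N) = w) :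
    ((∀ β β' : Gamma0 N, (β : SL(2, ℤ)) 0 1 = -1 → (β' : SL(2, ℤ)) 0 1 = -1 →
        ((((β : SL(2, ℤ)) 1 1 : ℤ) : ZMod N)) = u → ((((β' : SL(2, ℤ)) 1 1 : ℤ) : ZMod N)) = v → χ β = χ β') →
      ∀ β : Gamma0 N, (β : SL(2, ℤ)) 0 1 = -1 → ((((β : SL(2, ℤ)) 1 1 : ℤ) : ZMod N)) = w → χ β = 0) ∧
    ((∀ β β' : Gamma0 N, (β : SL(2, ℤ)) 0 1 = -1 → (β' : SL(2, ℤ)) 0 1 = -1 →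
        ((((β : SL(2, ℤ)) 1 1 : ℤ) : ZMod N)) = u → ((((β' : SL(2, ℤ)) 1 1 : ℤ) : ZMod N)) = w → χ β = χ β') →
      ∀ β : Gamma0 N, (β : SL(2, ℤ)) 0 1 = -1 → ((((β : SL(2, ℤ)) 1 1 : ℤ) : ZMod N)) = v → χ β = 0) ∧
    ((∀ β β' : Gamma0 N, (β : SL(2, ℤ)) 0 1 = -1 → (β' : SL(2, ℤ)) 0 1 = -1 →
        ((((β : SL(2, ℤ)) 1 1 : ℤ) : ZMod N)) = v → ((((β' : SL(2, ℤ)) 1 1 : ℤ) : ZMod N)) = w → χ β = χ β') →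
      ∀ β : Gamma0 N, (β : SL(2, ℤ)) 0 1 = -1 → ((((β : SL(2, ℤ)) 1 1 : ℤ) : ZMod N)) = u → χ β = 0) ∧
    ((∀ β : Gamma0 N, (β : SL(2, ℤ)) 0 1 = -1 → ((((β : SL(2, ℤ)) 1 1 : ℤ) : ZMod N)) = u → χ β = 0) →
      ∀ β β' : Gamma0 N, (β : SL(2, ℤ)) 0 1 = -1 → (β' : SL(2, ℤ)) 0 1 = -1 →
        ((((β : SL(2, ℤ)) 1 1 : ℤ) : ZMod N)) = v → ((((β' : SL(2, ℤ)) 1 1 : ℤ) : ZMod N)) = w → χ β = χ β') ∧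
    ((∀ β : Gamma0 N, (β : SL(2, ℤ)) 0 1 = -1 → ((((β : SL(2, ℤ)) 1 1 : ℤ) : ZMod N)) = v → χ β = 0) →
      ∀ β β' : Gamma0 N, (β : SL(2, ℤ)) 0 1 = -1 → (β' : SL(2, ℤ)) 0 1 = -1 →
        ((((β : SL(2, ℤ)) 1 1 : ℤ) : ZMod N)) = u → ((((β' : SL(2, ℤ)) 1 1 : ℤ) : ZMod N)) = w → χ β = χ β') ∧
    ((∀ β : Gamma0 N, (β : SL(2, ℤ)) 0 1 = -1 → ((((β : SL(2, ℤ)) 1 1 : ℤ) : ZMod N)) = w → χ β = 0) →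
      ∀ β β' : Gamma0 N, (β : SL(2, ℤ)) 0 1 = -1 → (β' : SL(2, ℤ)) 0 1 = -1 →
        ((((β : SL(2, ℤ)) 1 1 : ℤ) : ZMod N)) = u → ((((β' : SL(2, ℤ)) 1 1 : ℤ) : ZMod N)) = v → χ β = χ β') := by
  obtain ⟨β₁, h100, h101, h110, h111⟩ :=
    ThetaLayerLambdaCongruenceAtTwo.exists_gamma0_entries (N := N) a₁ (-1) c₁ d₁ (by linear_combination e1) hc1
  obtain ⟨β₂, h200, h201, h210, h211⟩ :=
    ThetaLayerLambdaCongruenceAtTwo.exists_gamma0_entries (N := N) a₂ (-1) c₂ d₂ (by linear_combination e2) hc2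
  have hb1 : ((β₁ * β₂ : Gamma0 N) : SL(2, ℤ)) 0 1 = 1 := by
    rw [gamma0_mul_apply_zero_one, h100, h201, h101, h211]; linear_combination (-1 : ℤ) * h12
  have hb : (((β₁ * β₂)⁻¹ : Gamma0 N) : SL(2, ℤ)) 0 1 = -1 := by
    have e : (((β₁ * β₂)⁻¹ : Gamma0 N) : SL(2, ℤ)) 0 1 = -(((β₁ * β₂ : Gamma0 N) : SL(2, ℤ)) 0 1) := by
      rw [InvMemClass.coe_inv, Matrix.SpecialLinearGroup.SL2_inv_expl]; rfl
    rw [e, hb1]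
  have hc : (((β₂ : SL(2, ℤ)) 1 0 : ℤ) : ZMod N) = 0 := by
    rw [h210]; exact (ZMod.intCast_zmod_eq_zero_iff_dvd _ N).mpr hc2
  have hdw : (((((β₁ * β₂)⁻¹ : Gamma0 N) : SL(2, ℤ)) 1 1 : ℤ) : ZMod N) = w := by
    rw [coe_inv_apply_one_one, gamma0_mul_apply_zero_zero', h100, h101, h200, ← hw]; push_cast; rw [hc]; ring
  refine KE_six hadd hsmall h101 h201 u v w (by rw [h111, hu]) (by rw [h211, hv])
    (by rw [← hdw]; exact isUnit_gamma0_apply_one_one _) ?_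
  intro γ hγ hd
  rw [chi_eq_of_apply_zero_one_eq_neg_one hadd hsmall hγ hb (by rw [hd, hdw]), map_inv_eq_of_additive hadd, hadd]
  generalize χ β₁ = x; generalize χ β₂ = y; revert x y; decide

/-- Transport along the `S`-companion: `K(r) → K(s)` for `r s = −1`. [folklore] -/
theorem K_of_K_S [NeZero N] (hadd : ∀ γ δ : Gamma0 N, χ (γ * δ) = χ γ + χ δ)
    (hsmall : ∀ γ : Gamma0 N, ((γ : SL(2, ℤ)) 0 0 + (γ : SL(2, ℤ)) 1 1).natAbs ≤ 2 → χ γ = 0)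
    (r s : ZMod N) (h : r * s = -1) :
    (∀ β : Gamma0 N, (β : SL(2, ℤ)) 0 1 = -1 → ((((β : SL(2, ℤ)) 1 1 : ℤ) : ZMod N)) = r → χ β = 0) →
    ∀ β : Gamma0 N, (β : SL(2, ℤ)) 0 1 = -1 → ((((β : SL(2, ℤ)) 1 1 : ℤ) : ZMod N)) = s → χ β = 0 := by
  intro K β' hb' hd'
  have hr : IsUnit r := IsUnit.of_mul_eq_one (-s) (by rw [mul_neg, h, neg_neg])
  obtain ⟨β, hb, hd⟩ := exists_b_neg_one_of_isUnit (N := N) hr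
  rw [← chi_eq_of_b_neg_one_of_mul_d_eq_neg_one hadd hsmall hb hb' (by rw [hd, hd', h]), K β hb hd]

end AnyLevel

section PrimeLevel

variable {p : ℕ} [Fact p.Prime] {χ : Gamma0 p → ZMod 2}

/-- `E(r, s)` from `r = 4 s` at an odd prime level (`…FourInvariance`, Dirichlet). [cite: Pollack2003, Conj. 6.3] -/
theorem E_of_eq_four_mul (hp2 : p ≠ 2) (hadd : ∀ γ δ : Gamma0 p, χ (γ * δ) = χ γ + χ δ)
    (hsmall : ∀ γ : Gamma0 p, ((γ : SL(2, ℤ)) 0 0 + (γ : SL(2, ℤ)) 1 1).natAbs ≤ 2 → χ γ = 0)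
    (hkill : ∀ γ : Gamma0 p, (∃ k : ℕ, 1 ≤ k ∧ ((γ : SL(2, ℤ)) 1 1).natAbs = 4 ^ k) → χ γ = 0)
    (r s : ZMod p) (h : r = 4 * s) :
    ∀ β β' : Gamma0 p, (β : SL(2, ℤ)) 0 1 = -1 → (β' : SL(2, ℤ)) 0 1 = -1 →
      ((((β : SL(2, ℤ)) 1 1 : ℤ) : ZMod p)) = r → ((((β' : SL(2, ℤ)) 1 1 : ℤ) : ZMod p)) = s → χ β = χ β' :=
  fun _ _ hb hb' hd hd' ↦ chi_eq_of_b_neg_one_of_d_eq_four_mul hp2 hadd hsmall hkill hb hb' (by rw [hd, hd', h])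

/-- Transport `K(r) → K(4r)` at an odd prime level. [cite: Pollack2003, Conj. 6.3] -/
theorem K_of_K_four (hp2 : p ≠ 2) (hadd : ∀ γ δ : Gamma0 p, χ (γ * δ) = χ γ + χ δ)
    (hsmall : ∀ γ : Gamma0 p, ((γ : SL(2, ℤ)) 0 0 + (γ : SL(2, ℤ)) 1 1).natAbs ≤ 2 → χ γ = 0)
    (hkill : ∀ γ : Gamma0 p, (∃ k : ℕ, 1 ≤ k ∧ ((γ : SL(2, ℤ)) 1 1).natAbs = 4 ^ k) → χ γ = 0)
    (r s : ZMod p) (h : s = 4 * r) :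
    (∀ β : Gamma0 p, (β : SL(2, ℤ)) 0 1 = -1 → ((((β : SL(2, ℤ)) 1 1 : ℤ) : ZMod p)) = r → χ β = 0) →
    ∀ β : Gamma0 p, (β : SL(2, ℤ)) 0 1 = -1 → ((((β : SL(2, ℤ)) 1 1 : ℤ) : ZMod p)) = s → χ β = 0 := by
  intro K β' hb' hd'
  have hs : IsUnit s := hd' ▸ isUnit_gamma0_apply_one_one β'
  have hr : IsUnit r := by rw [h] at hs; exact isUnit_of_mul_isUnit_right hs
  obtain ⟨β, hb, hd⟩ := exists_b_neg_one_of_isUnit (N := p) hr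
  rw [chi_eq_of_b_neg_one_of_d_eq_four_mul hp2 hadd hsmall hkill hb' hb (by rw [hd, hd', h]), K β hb hd]

/-- Transport `K(4s) → K(s)` at an odd prime level. [cite: Pollack2003, Conj. 6.3] -/
theorem K_of_K_four' (hp2 : p ≠ 2) (hadd : ∀ γ δ : Gamma0 p, χ (γ * δ) = χ γ + χ δ)
    (hsmall : ∀ γ : Gamma0 p, ((γ : SL(2, ℤ)) 0 0 + (γ : SL(2, ℤ)) 1 1).natAbs ≤ 2 → χ γ = 0)
    (hkill : ∀ γ : Gamma0 p, (∃ k : ℕ, 1 ≤ k ∧ ((γ : SL(2, ℤ)) 1 1).natAbs = 4 ^ k) → χ γ = 0)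
    (r s : ZMod p) (h : r = 4 * s) :
    (∀ β : Gamma0 p, (β : SL(2, ℤ)) 0 1 = -1 → ((((β : SL(2, ℤ)) 1 1 : ℤ) : ZMod p)) = r → χ β = 0) →
    ∀ β : Gamma0 p, (β : SL(2, ℤ)) 0 1 = -1 → ((((β : SL(2, ℤ)) 1 1 : ℤ) : ZMod p)) = s → χ β = 0 := by
  intro K β' hb' hd'
  have hs : IsUnit s := hd' ▸ isUnit_gamma0_apply_one_one β'
  have h4 : (4 : ZMod p) ≠ 0 := by
    -- (also `Literature…four_ne_zero_zmod`; inlined to keep the import light)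
    have hp : p.Prime := Fact.out
    intro h0
    have h0' : ((4 : ℕ) : ZMod p) = 0 := by exact_mod_cast h0
    have h4 : p ∣ 2 ^ 2 := by norm_num; exact (ZMod.natCast_eq_zero_iff 4 p).mp h0'
    exact hp2 ((Nat.prime_dvd_prime_iff_eq hp Nat.prime_two).mp (hp.dvd_of_dvd_pow h4))
  have hr : IsUnit r := h ▸ (isUnit_iff_ne_zero.mpr h4).mul hs
  obtain ⟨β, hb, hd⟩ := exists_b_neg_one_of_isUnit (N := p) hr
  rw [← chi_eq_of_b_neg_one_of_d_eq_four_mul hp2 hadd hsmall hkill hb hb' (by rw [hd, hd', h]), K β hb hd]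

end PrimeLevel

end Summit.BirchSwinnertonDyer.BirchSwinnertonDyer.Theorems.SignedMuAtTwo
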